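import Summits.HodgeConjecture.HodgeConjecture.Theorems.MarkmanPartnerTransportPicardThreeK3SquaresVeryGeneralSpread
import Summits.HodgeConjecture.HodgeConjecture.Theorems.MarkmanPartnerTransportPicardThreeK3SquaresRMSpreadOfCycleInduced
import Summits.HodgeConjecture.HodgeConjecture.Theorems.MarkmanPartnerTransportPicardThreeK3SquaresSymplecticLocus

/-!
# Route MarkmanPartnerTransport · crux `PicardThreeK3Squares` (stmt-HodgeConjecture-19652) —
# «NS-ABSORPTION»: Néron–Severi-supported endomorphisms of `H²(S)` are cycle-induced, spread families
# tolerate NS-noise, and HC for the VERY GENERAL fibre of a family through `S ⊗ S` gives HC⁴(`S ⊗ S`)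

Sequel to `…PicardThreeK3SquaresVeryGeneralSpread` (residual spread) and to the line «maximal-family
spread» (`…AlgebraicLocusSpread{,Section}`, `…RMSpreadDefs`, `…RMSpread`, `…RMSpreadOfCycleInduced`).

THE POINT (Noether–Lefschetz ascent of the real-multiplication third). A K3 surface `S` with real
multiplication by `E` (generator `t`, `T(S)_ℚ` of rank `[E:ℚ]·m`) and `ρ(S) ≥ [E:ℚ] + 3` is a SPECIAL
member of a real-multiplication family of LOWER Picard number `ρ(S) − [E:ℚ]`: choose a negative definite
`E`-trace form `N₀ ⊂ NS(S)_ℚ` (Hasse–Minkowski in codimension ≥ 3), let `E` act on `T⁺ = T(S)_ℚ ⊕ N₀`;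
the `t⁺`-eigenperiods form a period domain of dimension `m − 1` containing that of `S` as a hyperplane
section, and its very general point has `NS = N₀^⊥ ∩ NS(S)_ℚ`. Along that family the generator class
`κ(t⁺)` is FLAT, rational and Hodge, and at the special fibre `S ⊗ S` it restricts to
`κ(t) + κ(t⁺|_{N₀})` — the generator PLUS an endomorphism supported on the Néron–Severi classes. So
HC⁴ at the special square follows from HC⁴ at the VERY GENERAL squares of the bigger family, provided
(a) algebraicity spreads from a residual set of fibres (`VeryGeneralSpread`) and (b) the NS-supported
summand is itself cycle-induced. This file proves (b) and assembles the consumer; the family (the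
universal family over the real-multiplication component — moduli input (I1′) of the crux dossier) stays
a displayed hypothesis, exactly as in `RMSpreadFamily`.

* `exists_corr_of_neronSeveriSupported` — **every `ℂ`-linear endomorphism `f` of `H²(S(ℂ); ℂ)` with
  image in `N¹ = algebraicClasses S 1` and vanishing on `T = (N¹)^⊥` is `[γ]_* = fst_*(snd^*(–) ∪ γ)`
  for an algebraic `γ` on `S × S`** (any smooth projective surface, any orientation family): Gram-dual
  divisor basis by the Hodge index theorem (`exists_neronSeveri_gramBasis`), `f y = Σᵢ (∫ y ∪ dᵢ) f(dᵢ^∨)`,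
  and `fst^* d ∪ snd^* d'` acts as `y ↦ κ (∫ y ∪ d') d` (`corrFst_cross_of_cup_eq`, Fulton §16.1).
* `exists_corr_of_add_neronSeveriSupported` — **NS-absorption**: `t + f = [γ']_*` with `f`
  NS-supported ⟹ `t = [γ]_*`, `γ` algebraic.
* `nonempty_rmSpreadFamily_of_add_neronSeveriSupported` — the cell's displayed input is insensitive to
  NS-noise: `Nonempty (RMSpreadFamily S hS (t + f)) → Nonempty (RMSpreadFamily S hS t)`.
* `hodgeConjectureFor_square_of_residualFamily` (+ `_of_section`) — for a smooth projective surface `S`,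
  `t` rational, killing `N¹`, with `TranscendentalEndomorphismsGeneratedBy S t`, and `f` NS-supported: a
  smooth projective family through `S ⊗ S ≅ 𝒳_{b₁}` over a smooth irreducible quasi-projective base with
  a global class (resp. flat section of `R⁴`) inducing `t + f` at `b₁` and ALGEBRAIC ON A RESIDUAL SET OF
  FIBRES gives `HodgeConjectureFor 4 (S ⊗ S)` (spread, absorb, rung F4 `SquareOfGenerator`).
* `hodgeConjectureFor_square_of_residual_hodgeConjectureFor` (+ `_of_section`) — **the Hodge conjecture
  for the VERY GENERAL fibre of such a family (with the class rational and Hodge there) implies the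
  Hodge conjecture for the special square `S ⊗ S`.**
* `hodgeConjectureFor_square_of_isRealMultiplicationK3_of_noisySpreadFamilies` — closed form on the
  Literature predicate `IsRealMultiplicationK3 S ρ P`: spread families for `generator + NS-noise` suffice.

No definition, no sorry, no named-fact hypothesis (Voisin II Thm. 4.18 is the tree's
`deligne1968_invariantClass_fromTotalSpace_holds`). Prover seat hodge-nonav-19652-p1 (gen 18),
`--supports stmt-HodgeConjecture-19652`. Nothing here proves the crux or the Hodge conjecture: the
inputs (the family, and HC⁴ for its very general fibre) are hypotheses.

References: Fulton, *Intersection Theory* (1998), §16.1 Prop. 16.1.1; Kahn–Murre–Pedrini, in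
*Algebraic Cycles and Motives II* (2007), §7.2.2; Voisin, *Hodge Theory II* (2003), §3.3.1, §5.3.4
(Noether–Lefschetz loci), §7.3.2, Thm. 4.18; van Geemen–Schütt, Forum Math. Sigma 13 (2025) e2, §2.1,
§3.4 (dimension `m − 2` of the RM locus), §4.8; Varesco, Math. Z. 305 (2023) art. 69, §2 (p. 8);
O'Meara, *Introduction to Quadratic Forms*, 63:21 and 66:3 (representation in codimension ≥ 3).
-/

set_option linter.dupNamespace false

noncomputable section

namespace Summit.HodgeConjecture.HodgeConjecture.Theorems.MarkmanPartnerTransport.NSAbsorption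

open CategoryTheory MonoidalCategory CartesianMonoidalCategory AlgebraicGeometry Polynomial
open Literature.AlgebraicGeometry Literature.AlgebraicGeometry.Motives Literature.AlgebraicGeometry.HodgeTheory
open Literature.AlgebraicGeometry.Surfaces
open Literature.AlgebraicTopology.SingularHomology
open Summit.HodgeConjecture.HodgeConjecture.Theorems
open Summit.HodgeConjecture.HodgeConjecture.Theorems.NikulinTwinTransport
open Summit.HodgeConjecture.HodgeConjecture.Theorems.NikulinTwinTransport.SquareGlueFree
open Summit.HodgeConjecture.HodgeConjecture.Theorems.MarkmanPartnerTransport.AlgebraicLocusSpread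
open Summit.HodgeConjecture.HodgeConjecture.Theorems.MarkmanPartnerTransport.VeryGeneralSpread

variable {𝒳 B : SchemeOver ℂ}

/-! ### NS-absorption: Néron–Severi-supported endomorphisms are cycle-induced -/

variable {S : SchemeOver ℂ}

/-- `Corr[μ, hS ; γ, y] = fst_*(snd^* y ∪ γ)` on `H²(S(ℂ); ℂ)`. Local notation only. -/
local notation3 (prettyPrint := false) "Corr[" μ ", " hS " ; " γ ", " y "]" =>
  complexGysin μ (IsSmoothProjective.tensor_holds hS hS) hS
    (SemiCartesianMonoidalCategory.fst _ _) (rfl : 2 * 1 + 2 * 2 + 2 * 2 = 2 * 1 + 2 * (2 + 2))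
    (cupProduct (rfl : 2 * 1 + 2 * 2 = 2 * 1 + 2 * 2)
      (complexBetti.map (SemiCartesianMonoidalCategory.snd _ _) (2 * 1) y) γ)

/-- **Every endomorphism of `H²(S(ℂ); ℂ)` supported on the Néron–Severi classes is induced by an
algebraic class on `S × S`.** For a smooth projective surface `S` and a `ℂ`-linear `f` with image in
`N = N¹H²(S(ℂ); ℂ) = algebraicClasses S 1` vanishing on `T = N^⊥` (the classes cup-orthogonal to `N`):
`f = [γ]_* = fst_*(snd^*(–) ∪ γ)` for some `γ ∈ algebraicClasses (S ⊗ S) 2` and every orientation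
family `μ`. Proof: with a rational basis `dᵢ` of `N` and Gram-dual classes `dᵢ^∨` (Hodge index,
`exists_neronSeveri_gramBasis`), `y - Σᵢ (∫ y ∪ dᵢ) dᵢ^∨ ∈ T`, so `f y = Σᵢ (∫ y ∪ dᵢ) f(dᵢ^∨)`; writing
`f(dᵢ^∨) = Σₖ cᵢₖ dₖ`, the class `γ = κ⁻¹ Σᵢₖ cᵢₖ fst^* dₖ ∪ snd^* dᵢ` (products of pulled-back divisor
classes, `cupProduct_fst_snd_mem_algebraicClasses_of_eq`) acts as `f` (`corrFst_cross_of_cup_eq`).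
[cite: Fulton1998, §16.1 Prop. 16.1.1] [cite: KahnMurrePedrini2007, §7.2.2] [cite: Varesco2023, §2 (p. 8)] -/
theorem exists_corr_of_neronSeveriSupported (μ : OrientationFamily) (hS : IsSmoothProjective 2 S)
    (f : complexBetti S (2 * 1) →ₗ[ℂ] complexBetti S (2 * 1))
    (hfN : ∀ y, f y ∈ algebraicClasses S 1)
    (hfT : ∀ y : complexBetti S (2 * 1),
      (∀ d ∈ algebraicClasses S 1, cupProduct (rfl : 2 * 1 + 2 * 1 = 2 * 2) y d = 0) → f y = 0) :
    ∃ γ ∈ algebraicClasses (S ⊗ S) 2, ∀ y : complexBetti S (2 * 1), f y = Corr[μ, hS ; γ, y] := by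
  classical
  have h4 : 2 * 1 + 2 * 1 = 2 * 2 := rfl
  set N : Submodule ℂ (complexBetti S (2 * 1)) := algebraicClasses S 1 with hNdef
  obtain ⟨r, d, M, hdQ, hdN, hdli, hspanN, hmulinv, hinvmul⟩ := exists_neronSeveri_gramBasis hS
  have hmemS : ∀ x ∈ N, x ∈ Submodule.span ℂ (Set.range d) := fun x hx ↦ by rw [hspanN]; exact hx
  set dv : Fin r → complexBetti S (2 * 1) := fun i ↦ ∑ j, ((M i j : ℚ) : ℂ) • d j with hdvdef
  have hdvN : ∀ i, dv i ∈ N := fun i ↦ Submodule.sum_mem _ fun j _ ↦ Submodule.smul_mem _ _ (hdN j)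
  -- `∫ dᵢ^∨ ∪ d_k = δ_{ik}`
  have htdv : ∀ i k, traceC hS (cupProduct h4 (dv i) (d k)) = if i = k then 1 else 0 := by
    intro i k
    rw [← hinvmul i k]
    simp only [hdvdef, map_sum, map_smul, LinearMap.sum_apply, LinearMap.smul_apply, smul_eq_mul]
  -- the projector `P y = Σᵢ (∫ y ∪ dᵢ) dᵢ^∨` onto `N`
  let P : complexBetti S (2 * 1) →ₗ[ℂ] complexBetti S (2 * 1) :=
    ∑ i, ((traceC hS) ∘ₗ ((cupProduct h4).flip (d i))).smulRight (dv i)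
  have hP : ∀ y, P y = ∑ i, traceC hS (cupProduct h4 y (d i)) • dv i := fun y ↦ by
    simp only [P, LinearMap.sum_apply, LinearMap.smulRight_apply, LinearMap.comp_apply,
      LinearMap.flip_apply]
  -- `y - P y` is cup-orthogonal to `N`
  have htr : ∀ y k, traceC hS (cupProduct h4 (P y) (d k)) = traceC hS (cupProduct h4 y (d k)) := by
    intro y k
    rw [hP]
    simp only [map_sum, map_smul, LinearMap.sum_apply, LinearMap.smul_apply, smul_eq_mul, htdv,
      mul_ite, mul_one, mul_zero, Finset.sum_ite_eq', Finset.mem_univ, if_true]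
  have hperp : ∀ y, ∀ e ∈ N, cupProduct h4 (y - P y) e = 0 := by
    intro y e he
    refine Submodule.span_induction (p := fun e _ ↦ cupProduct h4 (y - P y) e = 0) ?_ ?_ ?_ ?_ (hmemS e he)
    · rintro _ ⟨k, rfl⟩
      apply eq_zero_of_traceC_eq_zero hS
      rw [LinearMap.map_sub₂, map_sub, htr, sub_self]
    · rw [map_zero]
    · intro a b _ _ ha hb
      rw [map_add, ha, hb, add_zero]
    · intro c a _ ha
      rw [map_smul, ha, smul_zero]
  -- hence `f y = f (P y) = Σᵢ (∫ y ∪ dᵢ) f(dᵢ^∨)`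
  have hfP : ∀ y, f y = ∑ i, traceC hS (cupProduct h4 y (d i)) • f (dv i) := by
    intro y
    have h0 : f (y - P y) = 0 := hfT _ (hperp y)
    rw [map_sub, sub_eq_zero] at h0
    rw [h0, hP, map_sum]
    simp_rw [map_smul]
  -- coordinates of `f(dᵢ^∨)` in the basis `d`
  have hcoef : ∀ i, ∃ c : Fin r → ℂ, ∑ k, c k • d k = f (dv i) := fun i ↦
    (Submodule.mem_span_range_iff_exists_fun ℂ).1 (hmemS _ (hfN (dv i)))
  choose c hc using hcoef
  -- fibre integration along `fst`
  obtain ⟨ω, hω⟩ := exists_traceC_eq_one hS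
  have hω0 : ω ≠ 0 := by
    rintro rfl
    rw [map_zero] at hω
    exact zero_ne_one hω
  obtain ⟨κ, hκ0, hκ⟩ := exists_fibreIntegral_fst μ hS hS (kunnethSpan_complexBetti hS hS (2 * (2 + 2)))
    hω0 (rfl : 2 * 2 + 2 * 2 = 0 + 2 * (2 + 2))
  -- the class `Γ = Σᵢₖ cᵢₖ fst^* dₖ ∪ snd^* dᵢ`, acting as `κ f`
  set Γ : complexBetti (S ⊗ S) (2 * 2) :=
    ∑ i, ∑ k, c i k • cupProduct h4 (complexBetti.map (fst S S) (2 * 1) (d k))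
      (complexBetti.map (snd S S) (2 * 1) (d i)) with hΓdef
  have hΓalg : Γ ∈ algebraicClasses (S ⊗ S) 2 :=
    Submodule.sum_mem _ fun i _ ↦ Submodule.sum_mem _ fun k _ ↦ Submodule.smul_mem _ _
      (cupProduct_fst_snd_mem_algebraicClasses_of_eq hS hS (hdN k) (hdN i) (rfl : 1 + 1 = 2) h4)
  have hΓact : ∀ y, Corr[μ, hS ; Γ, y] = κ • f y := by
    intro y
    rw [hfP, Finset.smul_sum, hΓdef, map_sum, map_sum]
    refine Finset.sum_congr rfl fun i _ ↦ ?_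
    rw [map_sum, map_sum, ← hc i, Finset.smul_sum, Finset.smul_sum]
    refine Finset.sum_congr rfl fun k _ ↦ ?_
    rw [map_smul, map_smul,
      corrFst_cross_of_cup_eq μ hS hS h4 (rfl : 2 * 1 + 2 * 2 = 2 * 1 + 2 * 2) h4
        (rfl : 2 * 1 + 2 * 2 + 2 * 2 = 2 * 1 + 2 * (2 + 2)) (rfl : 2 * 2 + 2 * 2 = 0 + 2 * (2 + 2)) hκ
        (d k) (eq_traceC_smul hS hω (cupProduct h4 y (d i))), smul_smul, smul_smul, smul_smul]
    congr 1
    rw [show ((-1 : ℂ) ^ (2 * 1 * (2 * 1))) = 1 by norm_num, one_mul]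
    ring
  refine ⟨κ⁻¹ • Γ, Submodule.smul_mem _ _ hΓalg, fun y ↦ ?_⟩
  rw [map_smul, map_smul, hΓact, smul_smul, inv_mul_cancel₀ hκ0, one_smul]

/-- **NS-absorption.** If `t + f` is induced by an algebraic class on `S × S` and `f` is supported on
the Néron–Severi classes (image in `N¹`, zero on `T = (N¹)^⊥`), then `t` is induced by an algebraic
class on `S × S`. (On a Noether–Lefschetz specialisation of a real-multiplication family the flat
generator class restricts to `generator ⊕ (E acting on the newly algebraic classes)`: the second summand
is NS-supported, so the generator itself is cycle-induced as soon as the flat class is algebraic there.)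
[cite: Fulton1998, §16.1 Prop. 16.1.1] [cite: GeemenSchutt2023, §4.8] -/
theorem exists_corr_of_add_neronSeveriSupported (μ : OrientationFamily) (hS : IsSmoothProjective 2 S)
    (t f : complexBetti S (2 * 1) →ₗ[ℂ] complexBetti S (2 * 1))
    (hfN : ∀ y, f y ∈ algebraicClasses S 1)
    (hfT : ∀ y : complexBetti S (2 * 1),
      (∀ d ∈ algebraicClasses S 1, cupProduct (rfl : 2 * 1 + 2 * 1 = 2 * 2) y d = 0) → f y = 0)
    (h : ∃ γ' ∈ algebraicClasses (S ⊗ S) 2, ∀ y : complexBetti S (2 * 1), t y + f y = Corr[μ, hS ; γ', y]) :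
    ∃ γ ∈ algebraicClasses (S ⊗ S) 2, ∀ y : complexBetti S (2 * 1), t y = Corr[μ, hS ; γ, y] := by
  obtain ⟨γ', hγ', hγ't⟩ := h
  obtain ⟨γ₀, hγ₀, hγ₀f⟩ := exists_corr_of_neronSeveriSupported μ hS f hfN hfT
  refine ⟨γ' - γ₀, Submodule.sub_mem _ hγ' hγ₀, fun y ↦ ?_⟩
  rw [map_sub, map_sub, ← hγ't y, ← hγ₀f y, add_sub_cancel_right]

/-! ### The K3-square corollaries: HC for the very general fibre ⟹ HC for the special square -/

/-- **Residual-family reduction of the real-multiplication third (global-class form, with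
NS-absorption).** Let `S` be a smooth projective surface and `t` a rational endomorphism of
`H²(S(ℂ); ℂ)` killing `N¹` with `TranscendentalEndomorphismsGeneratedBy S t` (for a K3 surface with
real multiplication: a generator of `E = End_Hdg(T(S)_ℚ)`); let `f` be NS-supported (image in `N¹`,
zero on `T`). Suppose `S ⊗ S ≅ 𝒳_{b₁}` is a fibre of a smooth projective family `g : 𝒳 → B`
(quasi-projective total space; smooth irreducible quasi-projective base) carrying a global class
`W ∈ H⁴(𝒳(ℂ); ℂ)` whose value at that fibre induces `t + f`, and `W` is algebraic on a RESIDUAL set of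
fibres. Then the Hodge conjecture holds for `S ⊗ S`: the class spreads to `b₁`
(`forall_mem_algebraicClasses_of_residual`), the NS-noise is absorbed
(`exists_corr_of_add_neronSeveriSupported`), and the rung F4 `SquareOfGenerator.squareOfGenerator`
concludes. [cite: VoisinHodgeII2003, §7.3.2] [cite: Varesco2023, §2 (p. 8)] [cite: GeemenSchutt2023, §3.4 and §4.8] -/
theorem hodgeConjectureFor_square_of_residualFamily (hS : IsSmoothProjective 2 S)
    (t : complexBetti S (2 * 1) →ₗ[ℂ] complexBetti S (2 * 1))
    (ht_rat : ∀ y, IsRationalClass y → IsRationalClass (t y))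
    (ht_N : ∀ d ∈ algebraicClasses S 1, t d = 0)
    (hgen : TranscendentalEndomorphismsGeneratedBy S t)
    (f : complexBetti S (2 * 1) →ₗ[ℂ] complexBetti S (2 * 1))
    (hfN : ∀ y, f y ∈ algebraicClasses S 1)
    (hfT : ∀ y : complexBetti S (2 * 1),
      (∀ d ∈ algebraicClasses S 1, cupProduct (rfl : 2 * 1 + 2 * 1 = 2 * 2) y d = 0) → f y = 0)
    (g : 𝒳 ⟶ B) {n : ℕ} (hg : IsSmoothProjectiveFamily g n) (h𝒳 : IsQuasiProjectiveOver 𝒳)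
    (hB : IsQuasiProjectiveOver B) (hBsm : AlgebraicGeometry.Smooth B.hom) [IrreducibleSpace B.left]
    (W : complexBetti 𝒳 (2 * 2))
    (hres : ∀ᶠ b in residual (ComplexPoints B),
      complexBetti.map (fiberι g b) (2 * 2) W ∈ algebraicClasses (fiberOver g b) 2)
    (b₁ : ComplexPoints B) (e₁ : S ⊗ S ≅ fiberOver g b₁)
    (ht : ∀ y : complexBetti S (2 * 1),
      t y + f y = Corr[complexOrientationFamily, hS ;
        complexBetti.map e₁.hom (2 * 2) (complexBetti.map (fiberι g b₁) (2 * 2) W), y]) :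
    HodgeConjectureFor 4 (S ⊗ S) :=
  SquareOfGenerator.squareOfGenerator S hS t ht_rat ht_N
    (exists_corr_of_add_neronSeveriSupported complexOrientationFamily hS t f hfN hfT
      ⟨complexBetti.map e₁.hom (2 * 2) (complexBetti.map (fiberι g b₁) (2 * 2) W),
        map_mem_algebraicClasses_of_isIso e₁.hom
          (forall_mem_algebraicClasses_of_residual g hg h𝒳 hB hBsm W hres b₁), ht⟩) hgen

/-- **HC for the very general fibre ⟹ HC for the special K3 square (global-class form).** As
`hodgeConjectureFor_square_of_residualFamily`, with the residual algebraicity of `W` REPLACED by: for a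
residual set of `b ∈ B(ℂ)` the fibre `𝒳_b` satisfies the Hodge conjecture and `W|_{𝒳_b}` is a rational
`(2,2)`-class. The shape of the Noether–Lefschetz ASCENT: `S ⊗ S` a special fibre of the fibre-square
family over a real-multiplication component of LOWER Picard number, `W` the generator class (flat,
rational and Hodge along the component, equal to generator + NS-noise at `S ⊗ S`), and the Hodge
conjecture granted for the squares of the very general members only.
[cite: VoisinHodgeII2003, §7.3.2] [cite: GeemenSchutt2023, §3.4 and §4.8] [cite: Varesco2023, §2 (p. 8)] -/
theorem hodgeConjectureFor_square_of_residual_hodgeConjectureFor (hS : IsSmoothProjective 2 S)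
    (t : complexBetti S (2 * 1) →ₗ[ℂ] complexBetti S (2 * 1))
    (ht_rat : ∀ y, IsRationalClass y → IsRationalClass (t y))
    (ht_N : ∀ d ∈ algebraicClasses S 1, t d = 0)
    (hgen : TranscendentalEndomorphismsGeneratedBy S t)
    (f : complexBetti S (2 * 1) →ₗ[ℂ] complexBetti S (2 * 1))
    (hfN : ∀ y, f y ∈ algebraicClasses S 1)
    (hfT : ∀ y : complexBetti S (2 * 1),
      (∀ d ∈ algebraicClasses S 1, cupProduct (rfl : 2 * 1 + 2 * 1 = 2 * 2) y d = 0) → f y = 0)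
    (g : 𝒳 ⟶ B) {n : ℕ} (hg : IsSmoothProjectiveFamily g n) (h𝒳 : IsQuasiProjectiveOver 𝒳)
    (hB : IsQuasiProjectiveOver B) (hBsm : AlgebraicGeometry.Smooth B.hom) [IrreducibleSpace B.left]
    (W : complexBetti 𝒳 (2 * 2))
    (hHC : ∀ᶠ b in residual (ComplexPoints B), HodgeConjectureFor n (fiberOver g b))
    (hrat : ∀ᶠ b in residual (ComplexPoints B), IsRationalClass (complexBetti.map (fiberι g b) (2 * 2) W))
    (htyp : ∀ᶠ b in residual (ComplexPoints B),
      IsOfHodgeType n (fiberOver g b) (2 * 2) 2 2 (complexBetti.map (fiberι g b) (2 * 2) W))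
    (b₁ : ComplexPoints B) (e₁ : S ⊗ S ≅ fiberOver g b₁)
    (ht : ∀ y : complexBetti S (2 * 1),
      t y + f y = Corr[complexOrientationFamily, hS ;
        complexBetti.map e₁.hom (2 * 2) (complexBetti.map (fiberι g b₁) (2 * 2) W), y]) :
    HodgeConjectureFor 4 (S ⊗ S) := by
  refine hodgeConjectureFor_square_of_residualFamily hS t ht_rat ht_N hgen f hfN hfT g hg h𝒳 hB hBsm
    W ?_ b₁ e₁ ht
  filter_upwards [hHC, hrat, htyp] with b' hHC' hrat' htyp'
  exact hHC'.2 2 _ hrat' htyp'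

/-- **Residual-family reduction, flat-section form (unconditional).** As
`hodgeConjectureFor_square_of_residualFamily` with the global class replaced by a continuous section
`σ` of `FiberClass g 4` (a flat family of degree-4 fibre classes — the shape in which the generator
class of a real-multiplication family is born), algebraic on a residual set of fibres, whose value at
`b₁` induces `t + f` on `H²(S)`. [cite: VoisinHodgeII2003, Thm. 4.18 and §7.3.2] [cite: GeemenSchutt2023, §3.4 and §4.8] -/
theorem hodgeConjectureFor_square_of_residualFamily_of_section (hS : IsSmoothProjective 2 S)
    (t : complexBetti S (2 * 1) →ₗ[ℂ] complexBetti S (2 * 1))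
    (ht_rat : ∀ y, IsRationalClass y → IsRationalClass (t y))
    (ht_N : ∀ d ∈ algebraicClasses S 1, t d = 0)
    (hgen : TranscendentalEndomorphismsGeneratedBy S t)
    (f : complexBetti S (2 * 1) →ₗ[ℂ] complexBetti S (2 * 1))
    (hfN : ∀ y, f y ∈ algebraicClasses S 1)
    (hfT : ∀ y : complexBetti S (2 * 1),
      (∀ d ∈ algebraicClasses S 1, cupProduct (rfl : 2 * 1 + 2 * 1 = 2 * 2) y d = 0) → f y = 0)
    (g : 𝒳 ⟶ B) {n : ℕ} (hg : IsSmoothProjectiveFamily g n) (h𝒳 : IsQuasiProjectiveOver 𝒳)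
    (hB : IsQuasiProjectiveOver B) (hBsm : AlgebraicGeometry.Smooth B.hom) [IrreducibleSpace B.left]
    (σ : ComplexPoints B → FiberClass g (2 * 2)) (hσ : Continuous σ) (hpt : ∀ b, (σ b).pt = b)
    (hres : ∀ᶠ b in residual (ComplexPoints B), (σ b).clsAt (hpt b) ∈ algebraicClasses (fiberOver g b) 2)
    (b₁ : ComplexPoints B) (e₁ : S ⊗ S ≅ fiberOver g b₁)
    (ht : ∀ y : complexBetti S (2 * 1),
      t y + f y = Corr[complexOrientationFamily, hS ;
        complexBetti.map e₁.hom (2 * 2) ((σ b₁).clsAt (hpt b₁)), y]) :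
    HodgeConjectureFor 4 (S ⊗ S) :=
  SquareOfGenerator.squareOfGenerator S hS t ht_rat ht_N
    (exists_corr_of_add_neronSeveriSupported complexOrientationFamily hS t f hfN hfT
      ⟨complexBetti.map e₁.hom (2 * 2) ((σ b₁).clsAt (hpt b₁)),
        map_mem_algebraicClasses_of_isIso e₁.hom
          (forall_cls_mem_algebraicClasses_of_residual_of_section g hg h𝒳 hB hBsm σ hσ hpt hres b₁),
        ht⟩) hgen

/-- **HC for the very general fibre ⟹ HC for the special K3 square (flat-section form).** As
`hodgeConjectureFor_square_of_residual_hodgeConjectureFor` with a flat section `σ` of `R⁴ g_* ℂ`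
instead of a global class: if for a residual set of `b` the fibre satisfies the Hodge conjecture and
`(σ b).cls` is a rational `(2,2)`-class, and `(σ b₁).cls` induces `t + f` on the special fibre
`S ⊗ S ≅ 𝒳_{b₁}` (`t` rational, killing `N¹`, generating; `f` NS-supported), then
`HodgeConjectureFor 4 (S ⊗ S)`. [cite: VoisinHodgeII2003, Thm. 4.18 and §7.3.2] [cite: GeemenSchutt2023, §3.4 and §4.8]
[cite: Varesco2023, §2 (p. 8)] -/
theorem hodgeConjectureFor_square_of_residual_hodgeConjectureFor_of_section (hS : IsSmoothProjective 2 S)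
    (t : complexBetti S (2 * 1) →ₗ[ℂ] complexBetti S (2 * 1))
    (ht_rat : ∀ y, IsRationalClass y → IsRationalClass (t y))
    (ht_N : ∀ d ∈ algebraicClasses S 1, t d = 0)
    (hgen : TranscendentalEndomorphismsGeneratedBy S t)
    (f : complexBetti S (2 * 1) →ₗ[ℂ] complexBetti S (2 * 1))
    (hfN : ∀ y, f y ∈ algebraicClasses S 1)
    (hfT : ∀ y : complexBetti S (2 * 1),
      (∀ d ∈ algebraicClasses S 1, cupProduct (rfl : 2 * 1 + 2 * 1 = 2 * 2) y d = 0) → f y = 0)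
    (g : 𝒳 ⟶ B) {n : ℕ} (hg : IsSmoothProjectiveFamily g n) (h𝒳 : IsQuasiProjectiveOver 𝒳)
    (hB : IsQuasiProjectiveOver B) (hBsm : AlgebraicGeometry.Smooth B.hom) [IrreducibleSpace B.left]
    (σ : ComplexPoints B → FiberClass g (2 * 2)) (hσ : Continuous σ) (hpt : ∀ b, (σ b).pt = b)
    (hHC : ∀ᶠ b in residual (ComplexPoints B), HodgeConjectureFor n (fiberOver g b))
    (hrat : ∀ᶠ b in residual (ComplexPoints B), IsRationalClass ((σ b).clsAt (hpt b)))
    (htyp : ∀ᶠ b in residual (ComplexPoints B),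
      IsOfHodgeType n (fiberOver g b) (2 * 2) 2 2 ((σ b).clsAt (hpt b)))
    (b₁ : ComplexPoints B) (e₁ : S ⊗ S ≅ fiberOver g b₁)
    (ht : ∀ y : complexBetti S (2 * 1),
      t y + f y = Corr[complexOrientationFamily, hS ;
        complexBetti.map e₁.hom (2 * 2) ((σ b₁).clsAt (hpt b₁)), y]) :
    HodgeConjectureFor 4 (S ⊗ S) := by
  refine hodgeConjectureFor_square_of_residualFamily_of_section hS t ht_rat ht_N hgen f hfN hfT g hg
    h𝒳 hB hBsm σ hσ hpt ?_ b₁ e₁ ht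
  filter_upwards [hHC, hrat, htyp] with b' hHC' hrat' htyp'
  exact hHC'.2 2 _ hrat' htyp'

/-! ### The displayed input of the cell is insensitive to NS-noise -/

/-- **Spread families tolerate NS-noise**: if `t + f` admits an `RMSpreadFamily` (equivalently, is
induced by an algebraic class on `S × S`: `nonempty_rmSpreadFamily_iff_exists_algebraicClass`) and `f`
is supported on the Néron–Severi classes, then `t` admits an `RMSpreadFamily`. On a Noether–Lefschetz
specialisation the universal family of the BIGGER real-multiplication type, restricted to the fibre
square, is such a noisy spread family for the generator. [cite: GeemenSchutt2023, §3.4 and §4.8]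
[cite: Fulton1998, §16.1 Prop. 16.1.1] -/
theorem nonempty_rmSpreadFamily_of_add_neronSeveriSupported (hS : IsSmoothProjective 2 S)
    (t f : complexBetti S (2 * 1) →ₗ[ℂ] complexBetti S (2 * 1))
    (hfN : ∀ y, f y ∈ algebraicClasses S 1)
    (hfT : ∀ y : complexBetti S (2 * 1),
      (∀ d ∈ algebraicClasses S 1, cupProduct (rfl : 2 * 1 + 2 * 1 = 2 * 2) y d = 0) → f y = 0)
    (h : Nonempty (RMSpreadFamily S hS (t + f))) : Nonempty (RMSpreadFamily S hS t) := by
  rw [nonempty_rmSpreadFamily_iff_exists_algebraicClass] at h ⊢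
  refine exists_corr_of_add_neronSeveriSupported complexOrientationFamily hS t f hfN hfT ?_
  obtain ⟨γ', hγ', h'⟩ := h
  exact ⟨γ', hγ', fun y ↦ by rw [← LinearMap.add_apply]; exact h' y⟩

/-- **Row «RM-SPREAD» with NS-noise, closed form on the Literature predicate — UNCONDITIONAL in the
tree.** A K3 surface with real multiplication by `ℚ[X]/(P)` (`IsRealMultiplicationK3 S ρ P`) each of
whose generators `t` admits, for SOME NS-supported `f`, a spread family for `t + f`, satisfies
`HodgeConjectureFor 4 (S ⊗ S)` (`nonempty_rmSpreadFamily_of_add_neronSeveriSupported` +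
`hodgeConjectureFor_square_of_isRealMultiplicationK3_of_spreadFamilies'`). This is the shape supplied
by the Noether–Lefschetz ascent: the fibre square of the universal family of the real-multiplication
type of Picard number `ρ − [E:ℚ]` through `S`, with its flat generator class, once that class is
algebraic along a dominant sub-family. [cite: GeemenSchutt2023, §2.1, §3.4 and §4.8]
[cite: VoisinHodgeII2003, Thm. 4.18 and §7.3.2] [cite: Varesco2023, §2 (p. 8)] -/
theorem hodgeConjectureFor_square_of_isRealMultiplicationK3_of_noisySpreadFamilies {ρ : ℕ} {P : ℚ[X]}
    (h : IsRealMultiplicationK3 S ρ P)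
    (hF : ∀ t : complexBetti S (2 * 1) →ₗ[ℂ] complexBetti S (2 * 1),
      (∀ y, IsRationalClass y → IsRationalClass (t y)) →
      (∀ (i j : ℕ) (y : complexBetti S (2 * 1)),
        IsOfHodgeType 2 S (2 * 1) i j y → IsOfHodgeType 2 S (2 * 1) i j (t y)) →
      (∀ d ∈ algebraicClasses S 1, t d = 0) →
      (∀ (y : complexBetti S (2 * 1)), ∀ d ∈ algebraicClasses S 1,
        cupProduct (rfl : 2 * 1 + 2 * 1 = 2 * 2) (t y) d = 0) →
      IsAnnihilatedOnTranscendentalBy S t P → TranscendentalEndomorphismsGeneratedBy S t →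
      ∃ f : complexBetti S (2 * 1) →ₗ[ℂ] complexBetti S (2 * 1),
        (∀ y, f y ∈ algebraicClasses S 1) ∧
        (∀ y : complexBetti S (2 * 1),
          (∀ d ∈ algebraicClasses S 1, cupProduct (rfl : 2 * 1 + 2 * 1 = 2 * 2) y d = 0) → f y = 0) ∧
        Nonempty (RMSpreadFamily S h.isK3Surface.isSmoothProjective (t + f))) :
    HodgeConjectureFor 4 (S ⊗ S) := by
  refine hodgeConjectureFor_square_of_isRealMultiplicationK3_of_spreadFamilies' h ?_
  intro t ht_rat ht_typ ht_N ht_perp hP hgen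
  obtain ⟨f, hfN, hfT, hF'⟩ := hF t ht_rat ht_typ ht_N ht_perp hP hgen
  exact nonempty_rmSpreadFamily_of_add_neronSeveriSupported _ t f hfN hfT hF'

end Summit.HodgeConjecture.HodgeConjecture.Theorems.MarkmanPartnerTransport.NSAbsorption

end
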